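import Mathlib
import HarnessLib
import Summits.HubbardSuperconductivity.HubbardSuperconductivity.Theorems.KLProgrammeKLRegimeEnginePairTransferDLineEdgeSplit3DoorSharpTC
import Summits.HubbardSuperconductivity.HubbardSuperconductivity.Theorems.KLProgrammeKLRegimeEnginePairTransferDLineEdgeSplitCellsSharpTC

/-!
# Route `KLProgramme` — ENGINE stmt-HubbardSuperconductivity-20437 `KLRegimeEngineV17F2`, class-#5 STEP (X).3 budget side / row (c) value lane, THE PINNED PAIR «88b»:
# THE DOOR and THE ROOM SLOTS keyed on the ANGULAR-CELL row bound `klmsRowBoundTCC` and a finite window family (brick (L3)-8 of cure (A″) route 3′ of located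
# «(c)-OUT-COOPER-ANTIPODE»; cell gate-hubbard-kl, seat hubbard-kl-k3c2-p2 g26, technique «thermal-bar induction n ≤ nScales β + 1 with EngineBoundsAtV4S sums»)

Twins of `pinned_rowBound_readingTC`, `pinned_row_le_slotsTC`, `pinned_row_le_slots_shiftTC`, `dLine_pinned_direct/crossed_split3_doorTC` (…DLineEdgeSplit3DoorSharpTC) with
`klmsRowBoundTC A₁ L₁ ↦ klmsRowBoundTCC A₁ K_g I₁ I_δ` (…MemberPHSignedRowSharpTCCells) and ONE window ↦ a FINITE WINDOW FAMILY (…DLineEdgeSplitCellsSharpTC): the zero-sound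
slot constant reads the ARC-WEIGHTED Lipschitz sum, `ZS⋆_C = (64/π)·8·(π√2/(d−4A)/(d−4A)·I₁/(2π) + π√2/(d−4A)·40A₀/(d−4A) + 2A₀(1/(d−4A)² + π√2(2+4A)/(d−4A)³))` — i.e.
`ZS⋆_S` with `2L_A ↦ I₁/(2π)`; a new SCALE-FREE defect entry `(3/π)·DEF⋆`, `DEF⋆ = (128/π)·8·(π√2/(d−4A))·I_δ/(2π)` (`I_δ ∝ 1/L`: a lattice-slot entry); the lattice constant
carries the GLOBAL `K_g`; `TH⋆`, `TR⋆`, the flatness numeral `512·15367` and the window numeral `1024·15381` (now summed over the family) are unchanged.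
* `pinned_rowBound_readingTCC`, **`pinned_row_le_slotsTCC`**, **`pinned_row_le_slots_shiftTCC`**; **`dLine_pinned_direct_splitCells_doorTC`**, **`dLine_pinned_crossed_splitCells_doorTC`**.
Pure composition + real arithmetic over landed rows; nothing asserts (X).3, (c), K3 or superconductivity.  0 kit · 0 lit.
-/

noncomputable section

namespace Summit.HubbardSuperconductivity.HubbardSuperconductivity.Theorems.KLRegimeSplit

set_option linter.dupNamespace false -- summit = problem name (single-conjunct summit), D-0017

open Real Set Finset Complex Literature.MathematicalPhysics.QuantumLattice
open Literature.Probability.LatticeModels hiding torusSupNorm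
open Literature.MathematicalPhysics.QuantumLattice.BandSectorCounting
open Summit.HubbardSuperconductivity.HubbardSuperconductivity.Theorems.KLProgrammeLegKernels
open Summit.HubbardSuperconductivity.HubbardSuperconductivity.Theorems.KLRegimeWick
open Summit.HubbardSuperconductivity.HubbardSuperconductivity.Theorems.TwoPointAssembly
open Summit.HubbardSuperconductivity.HubbardSuperconductivity.Theorems.DispersionFlow
open Summit.HubbardSuperconductivity.HubbardSuperconductivity.Theorems.PerturbedFermiCurve
open Summit.HubbardSuperconductivity.HubbardSuperconductivity.Theorems.EngineV8

variable {L M : ℕ} [NeZero L] [NeZero M] (β μ : ℝ) (K : TrigPolyC4v)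

/-! ## §1 The angular-cell pinned row in the ROOM's monomials -/

omit [NeZero M] in
/-- **EXACT READING of the angular-cell pinned row at index `n+2`**:
`(Λₙ − Λₙ₊₁)·klmsRowBoundTCC d A G A₀ K_g I₁ I_δ β n (n+2) δ L = (3/(2π))·(ZS⋆_C·Λₙ₊₁ + DEF⋆ + TH⋆·((π/β)/Λₙ₊₁) + TR⋆·((|0| + δ)/Λₙ₊₁)) + LAT⋆(K_g)/L`. -/
theorem pinned_rowBound_readingTCC (d A G A₀ Kg I₁ Iδ : ℝ) (n : ℕ) (δ : ℝ) :
    (klScale klE0 n - klScale klE0 (n + 1)) * klmsRowBoundTCC d A G A₀ Kg I₁ Iδ β n (n + 2) δ L =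
      3 / (2 * π) *
          ((64 / Real.pi * 8 *
                (Real.pi * Real.sqrt 2 / (d - 4 * A) / (d - 4 * A) * (I₁ / (2 * π)) +
                  Real.pi * Real.sqrt 2 / (d - 4 * A) * (2 * A₀ * (2 / (1 / 10))) / (d - 4 * A) +
                  2 * A₀ * (1 / (d - 4 * A) ^ 2 + Real.pi * Real.sqrt 2 * (2 + 4 * A) / (d - 4 * A) ^ 3))) *
              klScale klE0 (n + 1) +
            128 / Real.pi * 8 * (Real.pi * Real.sqrt 2 / (d - 4 * A)) * (Iδ / (2 * π)) +
            (393216 / Real.pi * (64 * 16 + (2 * (448 / 3 * Real.exp 2) + 8) + 64) *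
                (2 * A₀ * (Real.pi * Real.sqrt 2 / (d - 4 * A)))) *
              ((Real.pi / β) / klScale klE0 (n + 1)) +
            ((64 / Real.pi * 8 * (2 * A₀ * (Real.pi * Real.sqrt 2 / (d - 4 * A))) * (3 * (8 * (16 : ℝ)) + 512 * 1) +
               48 / Real.pi * 8 * (2 * A₀ * (Real.pi * Real.sqrt 2 / (d - 4 * A))) * (3 * (8 * (16 : ℝ)) + 512 * 1) * ((Real.pi / β) / klScale klE0 (n + 1)))) *
              ((|(0 : ℝ)| + δ) / klScale klE0 (n + 1))) +
        96 * (512 * Kg / klScale klE0 (n + 1) +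
            32 * A₀ * G * ((9 * (2 * (448 / 3 * Real.exp 2) + 8) + 4 * 8) + (3 * (8 * (16 : ℝ)) + 512 * 1)) /
              klScale klE0 (n + 1) ^ 2) / L := by
  have h16 : (klScale klE0 (n + 1) / klScale klE0 (n + 2)) ^ 2 = 16 := by
    rw [klth_klScale_succ (n + 1)]; have h := (klth_klScale_pos (n + 1)).ne'; field_simp; norm_num
  have hpow : (16 : ℝ) ^ (n + 2 - (n + 1)) = 16 := by rw [show n + 2 - (n + 1) = 1 by omega, pow_one]
  rw [klmsRowBoundTCC_reading, h16, hpow]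
  ring

omit [NeZero M] in
/-- **THE PINNED ROW IN THE ROOM's MONOMIALS, angular-cell row** (`δ = G·r`, forward window `0 < r ≤ Λₙ₊₁`, `n ≤ n_β`, `klBetaMin ≤ β`, `0 < d − 4A`,
`0 ≤ A, G, A₀, I₁, I_δ`):
`2·(Λₙ−Λₙ₊₁)·Row^TCC_{n+2}(G·r) ≤ (3/π)·ZS⋆_C·klE0·(4ⁿ⁺¹)⁻¹ + (3/π)·DEF⋆ + (12/π)·(TH⋆ + TRt⋆·G)·(4^{n_β−n})⁻¹ + (3/π)·TRf⋆·G·min(r/Λₙ₊₁, Λₙ₊₁/r) + 2·LAT⋆/L`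
with the angular-cell zero-sound constant `ZS⋆_C` and the scale-free defect `(3/π)·DEF⋆`, the FLAT transfer constant `TRf⋆ = (64/π)·8·B_W·896` and its thermal companion `TRt⋆ = (48/π)·8·B_W·896`
(`B_W = 2A₀π√2/(d−4A)`; the companion's monomial `((π/β)/Λₙ₊₁)·G·min ≤ 4·4^{−(n_β−n)}·G` is booked in the thermal slot). -/
theorem pinned_row_le_slotsTCC {d A G A₀ Kg I₁ Iδ : ℝ} (hdA : 0 < d - 4 * A) (hA : 0 ≤ A) (hG : 0 ≤ G) (hA0 : 0 ≤ A₀) (hI1 : 0 ≤ I₁) (hIδ : 0 ≤ Iδ)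
    (hβ : klBetaMin ≤ β) {n : ℕ} (hn : n ≤ nScales β) {r : ℝ} (hr : 0 < r) (hrΛ : r ≤ klScale klE0 (n + 1)) :
    2 * ((klScale klE0 n - klScale klE0 (n + 1)) * klmsRowBoundTCC d A G A₀ Kg I₁ Iδ β n (n + 2) (G * r) L) ≤
      3 / π * (64 / Real.pi * 8 *
              (Real.pi * Real.sqrt 2 / (d - 4 * A) / (d - 4 * A) * (I₁ / (2 * π)) +
                Real.pi * Real.sqrt 2 / (d - 4 * A) * (2 * A₀ * (2 / (1 / 10))) / (d - 4 * A) +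
                2 * A₀ * (1 / (d - 4 * A) ^ 2 + Real.pi * Real.sqrt 2 * (2 + 4 * A) / (d - 4 * A) ^ 3))) *
          klE0 * ((4 : ℝ) ^ (n + 1))⁻¹ +
        12 / π * ((393216 / Real.pi * (64 * 16 + (2 * (448 / 3 * Real.exp 2) + 8) + 64) * (2 * A₀ * (Real.pi * Real.sqrt 2 / (d - 4 * A)))) +
            (48 / Real.pi * 8 * (2 * A₀ * (Real.pi * Real.sqrt 2 / (d - 4 * A))) * (3 * (8 * (16 : ℝ)) + 512 * 1)) * G) *
          ((4 : ℝ) ^ (nScales β - n))⁻¹ +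
        3 / π * (64 / Real.pi * 8 * (2 * A₀ * (Real.pi * Real.sqrt 2 / (d - 4 * A))) * (3 * (8 * (16 : ℝ)) + 512 * 1)) *
          (G * min (r / klScale klE0 (n + 1)) (klScale klE0 (n + 1) / r)) +
        3 / π * (128 / Real.pi * 8 * (Real.pi * Real.sqrt 2 / (d - 4 * A)) * (Iδ / (2 * π))) +
        2 * ((96 * (512 * Kg / klScale klE0 (n + 1) +
            32 * A₀ * G * ((9 * (2 * (448 / 3 * Real.exp 2) + 8) + 4 * 8) + (3 * (8 * (16 : ℝ)) + 512 * 1)) /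
              klScale klE0 (n + 1) ^ 2)) / L) := by
  have hπ := Real.pi_pos
  have hβ0 : 0 < β := lt_of_lt_of_le (by norm_num [klBetaMin]) hβ
  have hΛ1 := klth_klScale_pos (n + 1)
  rw [pinned_rowBound_readingTCC]
  -- abbreviate the closed constants
  set ZS : ℝ := 64 / Real.pi * 8 *
      (Real.pi * Real.sqrt 2 / (d - 4 * A) / (d - 4 * A) * (I₁ / (2 * π)) +
                Real.pi * Real.sqrt 2 / (d - 4 * A) * (2 * A₀ * (2 / (1 / 10))) / (d - 4 * A) +
                2 * A₀ * (1 / (d - 4 * A) ^ 2 + Real.pi * Real.sqrt 2 * (2 + 4 * A) / (d - 4 * A) ^ 3)) with hZS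
  set DEF : ℝ := 128 / Real.pi * 8 * (Real.pi * Real.sqrt 2 / (d - 4 * A)) * (Iδ / (2 * π)) with hDEF
  have hDEF0 : 0 ≤ DEF := by rw [hDEF]; positivity
  set TH : ℝ := (393216 / Real.pi * (64 * 16 + (2 * (448 / 3 * Real.exp 2) + 8) + 64) * (2 * A₀ * (Real.pi * Real.sqrt 2 / (d - 4 * A)))) with hTH
  set TRf : ℝ := (64 / Real.pi * 8 * (2 * A₀ * (Real.pi * Real.sqrt 2 / (d - 4 * A))) * (3 * (8 * (16 : ℝ)) + 512 * 1)) with hTRf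
  set TRt : ℝ := (48 / Real.pi * 8 * (2 * A₀ * (Real.pi * Real.sqrt 2 / (d - 4 * A))) * (3 * (8 * (16 : ℝ)) + 512 * 1)) with hTRt
  set LAT : ℝ := (96 * (512 * Kg / klScale klE0 (n + 1) +
            32 * A₀ * G * ((9 * (2 * (448 / 3 * Real.exp 2) + 8) + 4 * 8) + (3 * (8 * (16 : ℝ)) + 512 * 1)) /
              klScale klE0 (n + 1) ^ 2)) with hLAT
  obtain ⟨hZS0, hTH0, hTRf0, hTRt0⟩ : 0 ≤ ZS ∧ 0 ≤ TH ∧ 0 ≤ TRf ∧ 0 ≤ TRt :=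
    ⟨by rw [hZS]; positivity, by rw [hTH]; positivity, by rw [hTRf]; positivity, by rw [hTRt]; positivity⟩
  clear_value ZS DEF TH TRf TRt LAT
  -- the dictionary lines
  have hΛeq : klScale klE0 (n + 1) = klE0 * ((4 : ℝ) ^ (n + 1))⁻¹ := rfl
  have hth := klmsRoom_thermal_le hβ hn
  set q : ℝ := ((4 : ℝ) ^ (nScales β - n))⁻¹ with hq
  set p : ℝ := (Real.pi / β) / klScale klE0 (n + 1) with hp
  set mn : ℝ := min (r / klScale klE0 (n + 1)) (klScale klE0 (n + 1) / r) with hmn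
  have hp0 : 0 ≤ p := by rw [hp]; positivity
  have hth' : p ≤ 4 * q := hth
  have hmn0 : 0 ≤ mn := by rw [hmn]; exact le_min (by positivity) (by positivity)
  have hmn1 : mn ≤ 1 := min_slot_le_one hr hrΛ
  have hmin : (|(0 : ℝ)| + G * r) / klScale klE0 (n + 1) = G * mn := by
    rw [hmn, ← div_eq_min_of_le hr hrΛ, abs_zero, zero_add, mul_div_assoc]
  rw [hmin]
  have h1 : 3 / (2 * π) * (ZS * klScale klE0 (n + 1)) = 1 / 2 * (3 / π * ZS * klE0 * ((4 : ℝ) ^ (n + 1))⁻¹) := by rw [hΛeq]; ring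
  have h2 : 3 / (2 * π) * (TH * p) ≤ 1 / 2 * (12 / π * TH * q) := by
    have := mul_le_mul_of_nonneg_left hth' (by positivity : 0 ≤ 3 / (2 * π) * TH)
    calc 3 / (2 * π) * (TH * p) = 3 / (2 * π) * TH * p := by ring
      _ ≤ 3 / (2 * π) * TH * (4 * q) := this
      _ = 1 / 2 * (12 / π * TH * q) := by ring
  have h3 : 3 / (2 * π) * ((TRf + TRt * p) * (G * mn)) ≤ 1 / 2 * (3 / π * TRf * (G * mn)) + 1 / 2 * (12 / π * (TRt * G) * q) := by
    have hGmn : G * mn ≤ G := (mul_le_mul_of_nonneg_left hmn1 hG).trans_eq (mul_one G)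
    have ha : TRt * p * (G * mn) ≤ TRt * (4 * q) * G :=
      mul_le_mul (mul_le_mul_of_nonneg_left hth' hTRt0) hGmn (by positivity) (by positivity)
    have e : 3 / (2 * π) * ((TRf + TRt * p) * (G * mn)) = 1 / 2 * (3 / π * TRf * (G * mn)) + 3 / (2 * π) * (TRt * p * (G * mn)) := by ring
    rw [e]
    have : 3 / (2 * π) * (TRt * p * (G * mn)) ≤ 3 / (2 * π) * (TRt * (4 * q) * G) := mul_le_mul_of_nonneg_left ha (by positivity)
    have e2 : 3 / (2 * π) * (TRt * (4 * q) * G) = 1 / 2 * (12 / π * (TRt * G) * q) := by ring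
    linarith
  have hsplit : 3 / (2 * π) * (ZS * klScale klE0 (n + 1) + DEF + TH * p + (TRf + TRt * p) * (G * mn)) =
      3 / (2 * π) * (ZS * klScale klE0 (n + 1)) + 3 / (2 * π) * DEF + 3 / (2 * π) * (TH * p) + 3 / (2 * π) * ((TRf + TRt * p) * (G * mn)) := by ring
  rw [hsplit, h1]
  have hdef : 2 * (3 / (2 * π) * DEF) = 3 / π * DEF := by ring
  have e12 : 12 / π * (TH + TRt * G) * q = 12 / π * TH * q + 12 / π * (TRt * G) * q := by ring
  rw [e12]
  linarith

omit [NeZero M] in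
/-- **THE SHIFTED PINNED ROW IN THE ROOM's MONOMIALS, angular-cell row** (crossed row: `δ = |±2π/β| + G·r`; the bosonic shift and the count's
thermal companion are booked in the thermal slot, using `(π/β)/Λₙ₊₁ ≤ 4·4^{−(n_β−n)} ≤ 4`):
`2·(Λₙ−Λₙ₊₁)·Row^TCC_{n+2}(|±2π/β| + G·r) ≤ (3/π)·ZS⋆_C·klE0·(4ⁿ⁺¹)⁻¹ + (3/π)·DEF⋆ + (12/π)·(TH⋆ + 2·TRf⋆ + 8·TRt⋆ + TRt⋆·G)·(4^{n_β−n})⁻¹ + (3/π)·TRf⋆·G·min(r/Λₙ₊₁, Λₙ₊₁/r) + 2·LAT⋆/L`. -/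
theorem pinned_row_le_slots_shiftTCC {d A G A₀ Kg I₁ Iδ : ℝ} (hdA : 0 < d - 4 * A) (hA : 0 ≤ A) (hG : 0 ≤ G) (hA0 : 0 ≤ A₀) (hI1 : 0 ≤ I₁) (hIδ : 0 ≤ Iδ)
    (hβ : klBetaMin ≤ β) {n : ℕ} (hn : n ≤ nScales β) {r : ℝ} (hr : 0 < r) (hrΛ : r ≤ klScale klE0 (n + 1)) {s : ℝ} (hs : |s| = 2 * π / β) :
    2 * ((klScale klE0 n - klScale klE0 (n + 1)) * klmsRowBoundTCC d A G A₀ Kg I₁ Iδ β n (n + 2) (|s| + G * r) L) ≤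
      3 / π * (64 / Real.pi * 8 *
              (Real.pi * Real.sqrt 2 / (d - 4 * A) / (d - 4 * A) * (I₁ / (2 * π)) +
                Real.pi * Real.sqrt 2 / (d - 4 * A) * (2 * A₀ * (2 / (1 / 10))) / (d - 4 * A) +
                2 * A₀ * (1 / (d - 4 * A) ^ 2 + Real.pi * Real.sqrt 2 * (2 + 4 * A) / (d - 4 * A) ^ 3))) *
          klE0 * ((4 : ℝ) ^ (n + 1))⁻¹ +
        12 / π * ((393216 / Real.pi * (64 * 16 + (2 * (448 / 3 * Real.exp 2) + 8) + 64) * (2 * A₀ * (Real.pi * Real.sqrt 2 / (d - 4 * A)))) +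
            2 * (64 / Real.pi * 8 * (2 * A₀ * (Real.pi * Real.sqrt 2 / (d - 4 * A))) * (3 * (8 * (16 : ℝ)) + 512 * 1)) +
            8 * (48 / Real.pi * 8 * (2 * A₀ * (Real.pi * Real.sqrt 2 / (d - 4 * A))) * (3 * (8 * (16 : ℝ)) + 512 * 1)) +
            (48 / Real.pi * 8 * (2 * A₀ * (Real.pi * Real.sqrt 2 / (d - 4 * A))) * (3 * (8 * (16 : ℝ)) + 512 * 1)) * G) *
          ((4 : ℝ) ^ (nScales β - n))⁻¹ +
        3 / π * (64 / Real.pi * 8 * (2 * A₀ * (Real.pi * Real.sqrt 2 / (d - 4 * A))) * (3 * (8 * (16 : ℝ)) + 512 * 1)) *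
          (G * min (r / klScale klE0 (n + 1)) (klScale klE0 (n + 1) / r)) +
        3 / π * (128 / Real.pi * 8 * (Real.pi * Real.sqrt 2 / (d - 4 * A)) * (Iδ / (2 * π))) +
        2 * ((96 * (512 * Kg / klScale klE0 (n + 1) +
            32 * A₀ * G * ((9 * (2 * (448 / 3 * Real.exp 2) + 8) + 4 * 8) + (3 * (8 * (16 : ℝ)) + 512 * 1)) /
              klScale klE0 (n + 1) ^ 2)) / L) := by
  have hπ := Real.pi_pos
  have hβ0 : 0 < β := lt_of_lt_of_le (by norm_num [klBetaMin]) hβ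
  have hΛ1 := klth_klScale_pos (n + 1)
  rw [pinned_rowBound_readingTCC, hs]
  set ZS : ℝ := 64 / Real.pi * 8 *
      (Real.pi * Real.sqrt 2 / (d - 4 * A) / (d - 4 * A) * (I₁ / (2 * π)) +
                Real.pi * Real.sqrt 2 / (d - 4 * A) * (2 * A₀ * (2 / (1 / 10))) / (d - 4 * A) +
                2 * A₀ * (1 / (d - 4 * A) ^ 2 + Real.pi * Real.sqrt 2 * (2 + 4 * A) / (d - 4 * A) ^ 3)) with hZS
  set DEF : ℝ := 128 / Real.pi * 8 * (Real.pi * Real.sqrt 2 / (d - 4 * A)) * (Iδ / (2 * π)) with hDEF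
  have hDEF0 : 0 ≤ DEF := by rw [hDEF]; positivity
  set TH : ℝ := (393216 / Real.pi * (64 * 16 + (2 * (448 / 3 * Real.exp 2) + 8) + 64) * (2 * A₀ * (Real.pi * Real.sqrt 2 / (d - 4 * A)))) with hTH
  set TRf : ℝ := (64 / Real.pi * 8 * (2 * A₀ * (Real.pi * Real.sqrt 2 / (d - 4 * A))) * (3 * (8 * (16 : ℝ)) + 512 * 1)) with hTRf
  set TRt : ℝ := (48 / Real.pi * 8 * (2 * A₀ * (Real.pi * Real.sqrt 2 / (d - 4 * A))) * (3 * (8 * (16 : ℝ)) + 512 * 1)) with hTRt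
  set LAT : ℝ := (96 * (512 * Kg / klScale klE0 (n + 1) +
            32 * A₀ * G * ((9 * (2 * (448 / 3 * Real.exp 2) + 8) + 4 * 8) + (3 * (8 * (16 : ℝ)) + 512 * 1)) /
              klScale klE0 (n + 1) ^ 2)) with hLAT
  obtain ⟨hZS0, hTH0, hTRf0, hTRt0⟩ : 0 ≤ ZS ∧ 0 ≤ TH ∧ 0 ≤ TRf ∧ 0 ≤ TRt :=
    ⟨by rw [hZS]; positivity, by rw [hTH]; positivity, by rw [hTRf]; positivity, by rw [hTRt]; positivity⟩
  clear_value ZS DEF TH TRf TRt LAT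
  have hΛeq : klScale klE0 (n + 1) = klE0 * ((4 : ℝ) ^ (n + 1))⁻¹ := rfl
  have hth := klmsRoom_thermal_le hβ hn
  set q : ℝ := ((4 : ℝ) ^ (nScales β - n))⁻¹ with hq
  set p : ℝ := (Real.pi / β) / klScale klE0 (n + 1) with hp
  set mn : ℝ := min (r / klScale klE0 (n + 1)) (klScale klE0 (n + 1) / r) with hmn
  have hp0 : 0 ≤ p := by rw [hp]; positivity
  have hth' : p ≤ 4 * q := hth
  have hq1 : q ≤ 1 := by
    rw [hq]; exact inv_le_one_of_one_le₀ (one_le_pow₀ (by norm_num))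
  have hp4 : p ≤ 4 := hth'.trans ((mul_le_mul_of_nonneg_left hq1 (by norm_num : (0 : ℝ) ≤ 4)).trans_eq (mul_one 4))
  have hmn0 : 0 ≤ mn := by rw [hmn]; exact le_min (by positivity) (by positivity)
  have hmn1 : mn ≤ 1 := min_slot_le_one hr hrΛ
  have hsplit : (|(0 : ℝ)| + (2 * π / β + G * r)) / klScale klE0 (n + 1) = 2 * p + G * mn := by
    rw [hmn, ← div_eq_min_of_le hr hrΛ, abs_zero, zero_add, hp]
    field_simp
  rw [hsplit]
  have h1 : 3 / (2 * π) * (ZS * klScale klE0 (n + 1)) = 1 / 2 * (3 / π * ZS * klE0 * ((4 : ℝ) ^ (n + 1))⁻¹) := by rw [hΛeq]; ring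
  have h2 : 3 / (2 * π) * (TH * p) ≤ 1 / 2 * (12 / π * TH * q) := by
    have := mul_le_mul_of_nonneg_left hth' (by positivity : 0 ≤ 3 / (2 * π) * TH)
    calc 3 / (2 * π) * (TH * p) = 3 / (2 * π) * TH * p := by ring
      _ ≤ 3 / (2 * π) * TH * (4 * q) := this
      _ = 1 / 2 * (12 / π * TH * q) := by ring
  -- the transfer piece against `2p + G·mn`
  have hGmn : G * mn ≤ G := (mul_le_mul_of_nonneg_left hmn1 hG).trans_eq (mul_one G)
  have h2p : 2 * p ≤ 8 * q := (mul_le_mul_of_nonneg_left hth' (by norm_num : (0 : ℝ) ≤ 2)).trans_eq (by ring)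
  have ha : TRf * (2 * p) ≤ TRf * (8 * q) := mul_le_mul_of_nonneg_left h2p hTRf0
  have hb : TRt * p * (2 * p) ≤ TRt * (32 * q) := by
    have h8 : p * (2 * p) ≤ 4 * (2 * p) := mul_le_mul_of_nonneg_right hp4 (by positivity)
    have h32 : 4 * (2 * p) ≤ 32 * q := (mul_le_mul_of_nonneg_left h2p (by norm_num : (0 : ℝ) ≤ 4)).trans_eq (by ring)
    calc TRt * p * (2 * p) = TRt * (p * (2 * p)) := by ring
      _ ≤ TRt * (32 * q) := mul_le_mul_of_nonneg_left (h8.trans h32) hTRt0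
  have hc : TRt * p * (G * mn) ≤ TRt * (4 * q) * G :=
    mul_le_mul (mul_le_mul_of_nonneg_left hth' hTRt0) hGmn (by positivity) (by positivity)
  have h3 : 3 / (2 * π) * ((TRf + TRt * p) * (2 * p + G * mn)) ≤
      1 / 2 * (12 / π * (2 * TRf + 8 * TRt + TRt * G) * q) + 1 / 2 * (3 / π * TRf * (G * mn)) := by
    have e : (TRf + TRt * p) * (2 * p + G * mn) = TRf * (2 * p) + TRf * (G * mn) + TRt * p * (2 * p) + TRt * p * (G * mn) := by ring
    rw [e]
    have hsum : TRf * (2 * p) + TRf * (G * mn) + TRt * p * (2 * p) + TRt * p * (G * mn) ≤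
        TRf * (8 * q) + TRf * (G * mn) + TRt * (32 * q) + TRt * (4 * q) * G := by linarith
    have := mul_le_mul_of_nonneg_left hsum (by positivity : 0 ≤ 3 / (2 * π))
    have e2 : 3 / (2 * π) * (TRf * (8 * q) + TRf * (G * mn) + TRt * (32 * q) + TRt * (4 * q) * G) =
        1 / 2 * (12 / π * (2 * TRf + 8 * TRt + TRt * G) * q) + 1 / 2 * (3 / π * TRf * (G * mn)) := by ring
    linarith
  have hsum : 3 / (2 * π) * (ZS * klScale klE0 (n + 1) + DEF + TH * p + (TRf + TRt * p) * (2 * p + G * mn)) =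
      3 / (2 * π) * (ZS * klScale klE0 (n + 1)) + 3 / (2 * π) * DEF + 3 / (2 * π) * (TH * p) + 3 / (2 * π) * ((TRf + TRt * p) * (2 * p + G * mn)) := by ring
  rw [hsum, h1]
  have hdef : 2 * (3 / (2 * π) * DEF) = 3 / π * DEF := by ring
  have e12 : 12 / π * (TH + 2 * TRf + 8 * TRt + TRt * G) * q = 12 / π * TH * q + 12 / π * (2 * TRf + 8 * TRt + TRt * G) * q := by ring
  rw [e12]
  linarith

/-! ## §2 The cell-split rows in the door's normalisation -/

section Door

variable {a' b' : ℝ} (B : BandBounds a' b') {R : RenConsts} {U : ℝ} {N : ℕ} {A : ℝ}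

/-- **DIRECT CELL-SPLIT ROW IN THE DOOR's NORMALISATION**: `(Λₙ−Λₙ₊₁)((βL²)³)⁻¹·‖S_D‖ ≤ 2(Λₙ−Λₙ₊₁)Row_{n+2}(2‖c‖,0) + 2(Λₙ−Λₙ₊₁)Row^C_{n+2}(A₁,K_g,I₁,I_δ) + ε₁·(512·15367) +
Σ_w A₂ʷ·(1024·15381)·(ρ_w/π + 1/L)` (the ROOM rows are `pinned_row_le_slotsTC(C)`'s input; hypotheses as `dLine_pinned_direct_signed_le_splitCellsTC`). -/
theorem dLine_pinned_direct_splitCells_doorTC (hR : ∀ j, 0 ≤ R.Gfr j) (hK : FrameOK R U N μ K)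
    (hAb : ∀ p : Momentum, ∀ j ≤ 2, ‖iteratedFDeriv ℝ j (frameShift K) p‖ ≤ A) (hA : 4 * A < B.Dtmin) (hA20 : 4 * A ≤ 1 / 20) (hμ : μ ≤ -0.15)
    (n : ℕ) {t : ℝ} (ht : t ∈ Icc (0 : ℝ) 1) (hβ : klBetaMin ≤ β) (hβL : β ≤ L) (hn : n + 1 ≤ nScales β + 1)
    (hM : β * (4 * klScale klE0 (n + 1)) / (2 * Real.pi) + 1 ≤ M)
    (Wd : ℝ → FreqMomentum L M → ℝ) (hWd : Wd = fun t k => deriv (fun Λ' : ℝ => hubbardCutoffWeightCT L M β μ K Λ' k) (klScale klE0 n + t * (klScale klE0 (n + 1) - klScale klE0 n)))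
    (V : ℕ → ℝ → (Fin 4 → HubbardFieldIdx L M) → ℂ) {j : ℕ} (hj : n + 2 ≤ j) (Qm x y : TorusSite 2 L)
    (hlo : a' < μ - 4 * klScale klE0 (n + 1) - 4 * A) (hhi : μ + 4 * klScale klE0 (n + 1) + 4 * A < b')
    (hq : (4 + 8 / 3 * R.Gfr 1 * U ^ 2) * klTorusNorm L (x - y) ≤ klScale klE0 (n + 1) / 8)
    (c : ℂ) (F₁ : FreqMomentum L M → Fin 2 → FreqMomentum L M → ℂ) {ι' : Type*} [Fintype ι'] (F₂ : ι' → FreqMomentum L M → Fin 2 → FreqMomentum L M → ℂ)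
    (F₁₀ : TorusSite 2 L → Fin 2 → TorusSite 2 L → ℂ)
    (hsplit : ∀ (p : FreqMomentum L M) (σ : Fin 2) (p' : FreqMomentum L M),
      V j t ![((p, σ), 1), ((p', σ), 0), (((omega0 M, y), 0), 0), (((omega0 M, x), 0), 1)] *
          V j t ![((p, σ), 0), ((p', σ), 1), ((((omega0 M).rev, Qm - y), 1), 0), ((((omega0 M).rev, Qm - x), 1), 1)] = c + F₁ p σ p' + ∑ w, F₂ w p σ p')
    {A₁ Kg ε₁ : ℝ} (hA1 : 0 ≤ A₁) (hKg : 0 ≤ Kg) (hε1 : 0 ≤ ε₁)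
    (hY0p₁ : ∀ k : TorusSite 2 L, ‖∑ σ : Fin 2, F₁₀ k σ (k + (x - y))‖ ≤ A₁)
    (hY1p₁ : ∀ k k' : TorusSite 2 L, ‖(∑ σ : Fin 2, F₁₀ k σ (k + (x - y))) - ∑ σ : Fin 2, F₁₀ k' σ (k' + (x - y))‖ ≤ Kg * klTorusNorm L (k - k'))
    (hY0m₁ : ∀ k : TorusSite 2 L, ‖∑ σ : Fin 2, F₁₀ (k + -(x - y)) σ k‖ ≤ A₁)
    (hY1m₁ : ∀ k k' : TorusSite 2 L, ‖(∑ σ : Fin 2, F₁₀ (k + -(x - y)) σ k) - ∑ σ : Fin 2, F₁₀ (k' + -(x - y)) σ k'‖ ≤ Kg * klTorusNorm L (k - k'))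
    {ι : Type*} [Fintype ι] {S : ι → Finset (TorusSite 2 L)} {αc βc Lc : ι → ℝ} (hαβ : ∀ c, αc c ≤ βc c) (hLc : ∀ c, 0 ≤ Lc c)
    {r : ℝ} (hr : 4 * klScale klE0 (n + 1) / (B.Dtmin - 4 * A) + Real.pi / L ≤ r)
    (hserve : ∀ c, ∀ θ ∈ Icc (αc c) (βc c), ∀ k : TorusSite 2 L,
      torusSupNorm (klpeP L k -
        (perturbedFermiRadius (fun k : Fin 2 → ℝ => frameShift K (WithLp.toLp 2 k)) μ θ * Real.cos θ,
          perturbedFermiRadius (fun k : Fin 2 → ℝ => frameShift K (WithLp.toLp 2 k)) μ θ * Real.sin θ)) ≤ r → k ∈ S c)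
    (hcover : ∀ θ ∈ Ioo (-π) π, ∃ c, θ ∈ Icc (αc c) (βc c))
    (hcellp : ∀ c, ∀ k ∈ S c, ∀ k' ∈ S c, ‖(∑ σ : Fin 2, F₁₀ k σ (k + (x - y))) - ∑ σ : Fin 2, F₁₀ k' σ (k' + (x - y))‖ ≤ Lc c * klTorusNorm L (k - k'))
    (hcellm : ∀ c, ∀ k ∈ S c, ∀ k' ∈ S c, ‖(∑ σ : Fin 2, F₁₀ (k + -(x - y)) σ k) - ∑ σ : Fin 2, F₁₀ (k' + -(x - y)) σ k'‖ ≤ Lc c * klTorusNorm L (k - k'))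
    (hflat₁ : ∀ (i : MatsubaraIdx M) (σ : Fin 2) (k k' : TorusSite 2 L), matsubaraFreq β M i ^ 2 ≤ (4 * klScale klE0 (n + 1)) ^ 2 →
      ‖F₁ (i, k) σ (i, k') - F₁₀ k σ k'‖ ≤ ε₁)
    (cen : ι' → TorusSite 2 L) {ρ A₂ : ι' → ℝ} (hρ : ∀ w, 0 ≤ ρ w) (hA2 : ∀ w, 0 ≤ A₂ w)
    (hF₂ : ∀ w (p : FreqMomentum L M) (σ : Fin 2) (p' : FreqMomentum L M), ‖F₂ w p σ p'‖ ≤ A₂ w)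
    (hsupp₂ : ∀ w (p : FreqMomentum L M) (σ : Fin 2) (p' : FreqMomentum L M), ρ w < klTorusNorm L (p.2 - cen w) → F₂ w p σ p' = 0) :
    (klScale klE0 n - klScale klE0 (n + 1)) * ((β * (L : ℝ) ^ 2) ^ 3)⁻¹ *
        ‖∑ p : FreqMomentum L M, ∑ σ : Fin 2, ∑ p' : FreqMomentum L M,
          if matsubaraInt M p'.1 + matsubaraInt M (omega0 M) = matsubaraInt M p.1 + matsubaraInt M (omega0 M) ∧ p'.2 = p.2 + x - y then
            ((((((softSymbolCompl L M β μ K (n + 1) j p - softSymbolCompl L M β μ K (n + 1) (n + 1) p) : ℝ) : ℂ) * (((β * (L : ℝ) ^ 2 : ℝ) : ℂ) * propCT L M β μ K p)) *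
                  ((((Wd t p') : ℝ) : ℂ) * (((β * (L : ℝ) ^ 2 : ℝ) : ℂ) * propCT L M β μ K p'))) +
                (((((Wd t p) : ℝ) : ℂ) * (((β * (L : ℝ) ^ 2 : ℝ) : ℂ) * propCT L M β μ K p)) *
                  ((((softSymbolCompl L M β μ K (n + 1) j p' - softSymbolCompl L M β μ K (n + 1) (n + 1) p') : ℝ) : ℂ) * (((β * (L : ℝ) ^ 2 : ℝ) : ℂ) * propCT L M β μ K p')))) *
              (V j t ![((p, σ), 1), ((p', σ), 0), (((omega0 M, y), 0), 0), (((omega0 M, x), 0), 1)] *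
                V j t ![((p, σ), 0), ((p', σ), 1), ((((omega0 M).rev, Qm - y), 1), 0), ((((omega0 M).rev, Qm - x), 1), 1)])
          else 0‖ ≤
      2 * ((klScale klE0 n - klScale klE0 (n + 1)) *
          klmsRowBoundTC B.Dtmin A (4 + 8 / 3 * R.Gfr 1 * U ^ 2) (2 * ‖c‖) 0 β n (n + 2) ((4 + 8 / 3 * R.Gfr 1 * U ^ 2) * klTorusNorm L (x - y)) L) +
        2 * ((klScale klE0 n - klScale klE0 (n + 1)) *
          klmsRowBoundTCC B.Dtmin A (4 + 8 / 3 * R.Gfr 1 * U ^ 2) A₁ Kg (∑ c, Lc c * (βc c - αc c))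
            (∑ c, (2 * Lc c + 4 * Kg) * (Real.pi / L) * (βc c - αc c)) β n (n + 2) ((4 + 8 / 3 * R.Gfr 1 * U ^ 2) * klTorusNorm L (x - y)) L) +
        ε₁ * (512 * 15367) + ∑ w, A₂ w * (1024 * 15381) * (ρ w / π + ((L : ℝ))⁻¹) := by
  have hβ0 : 0 < β := lt_of_lt_of_le (by norm_num [klBetaMin]) hβ
  have hL : (0 : ℝ) < L := by exact_mod_cast Nat.pos_of_ne_zero (NeZero.ne L)
  have hBL : β * (L : ℝ) ^ 2 ≠ 0 := by positivity
  have hκ : 0 ≤ (klScale klE0 n - klScale klE0 (n + 1)) * ((β * (L : ℝ) ^ 2) ^ 3)⁻¹ := by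
    refine mul_nonneg ?_ (by positivity)
    rw [klth_klScale_succ]; linarith [klth_klScale_pos n]
  have h := dLine_pinned_direct_signed_le_splitCellsTC β μ K B hR hK hAb hA hA20 hμ n ht hβ hβL hn hM Wd hWd V hj Qm x y hlo hhi hq c F₁ F₂ F₁₀ hsplit
    hA1 hKg hε1 hY0p₁ hY1p₁ hY0m₁ hY1m₁ hαβ hLc hr hserve hcover hcellp hcellm hflat₁ cen hρ hA2 hF₂ hsupp₂
  have hE := pinned_flat_le (M := M) β μ K hK hβ hβL n ht hε1 (C := 512 / 3) (by norm_num) le_rfl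
  have hW : (klScale klE0 n - klScale klE0 (n + 1)) * ((β * (L : ℝ) ^ 2) ^ 3)⁻¹ *
      (∑ w, A₂ w * (512 / 3 * (β * (L : ℝ) ^ 2) ^ 2 / (klScale klE0 n + t * (klScale klE0 (n + 1) - klScale klE0 n)) ^ 2 *
        (2 * (15381 * (ρ w / π + ((L : ℝ))⁻¹) * klScale klE0 (n + 1) * β * (L : ℝ) ^ 2)))) ≤
      ∑ w, A₂ w * (1024 * 15381) * (ρ w / π + ((L : ℝ))⁻¹) := by
    rw [Finset.mul_sum]
    exact Finset.sum_le_sum fun w _ => window_flat_le (L := L) β hβ0 n (m := n + 1) le_rfl ht (hA2 w) (C := 512 / 3) le_rfl (hρ w)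
  have hmain := door_split3_arith hBL h hκ hE hW
  linarith [hmain]

/-- **CROSSED CELL-SPLIT ROW IN THE DOOR's NORMALISATION**: `(Λₙ−Λₙ₊₁)((βL²)³)⁻¹·‖S_{D,x}‖ ≤ (Λₙ−Λₙ₊₁)(Row_{n+2}(‖c‖,0; δ₋) + Row_{n+2}(‖c‖,0; δ₊)) +
(Λₙ−Λₙ₊₁)(Row^C_{n+2}(A₁,K_g,I₁,I_δ; δ₋) + Row^C_{n+2}(…; δ₊)) + ε₁·(512·15367) + Σ_w A₂ʷ·(1024·15381)·(ρ_w/π + 1/L)`, `δ∓ = |∓2π/β| + G·|p_{Q_m−x−y}|_𝕋`. -/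
theorem dLine_pinned_crossed_splitCells_doorTC (hR : ∀ j, 0 ≤ R.Gfr j) (hK : FrameOK R U N μ K)
    (hAb : ∀ p : Momentum, ∀ j ≤ 2, ‖iteratedFDeriv ℝ j (frameShift K) p‖ ≤ A) (hA : 4 * A < B.Dtmin) (hA20 : 4 * A ≤ 1 / 20) (hμ : μ ≤ -0.15)
    (n : ℕ) {t : ℝ} (ht : t ∈ Icc (0 : ℝ) 1) (hβ : klBetaMin ≤ β) (hβL : β ≤ L) (hn : n + 1 ≤ nScales β + 1) (hβn : 16 * π / β ≤ klScale klE0 (n + 1))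
    (hM : β * (4 * klScale klE0 (n + 1)) / (2 * Real.pi) + 1 ≤ M)
    (Wd : ℝ → FreqMomentum L M → ℝ) (hWd : Wd = fun t k => deriv (fun Λ' : ℝ => hubbardCutoffWeightCT L M β μ K Λ' k) (klScale klE0 n + t * (klScale klE0 (n + 1) - klScale klE0 n)))
    (V : ℕ → ℝ → (Fin 4 → HubbardFieldIdx L M) → ℂ) {j : ℕ} (hj : n + 2 ≤ j) (Qm x y : TorusSite 2 L)
    (hlo : a' < μ - 4 * klScale klE0 (n + 1) - 4 * A) (hhi : μ + 4 * klScale klE0 (n + 1) + 4 * A < b')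
    (hq : (4 + 8 / 3 * R.Gfr 1 * U ^ 2) * klTorusNorm L (Qm - x - y) ≤ klScale klE0 (n + 1) / 16)
    (c : ℂ) (F₁ : FreqMomentum L M → FreqMomentum L M → ℂ) {ι' : Type*} [Fintype ι'] (F₂ : ι' → FreqMomentum L M → FreqMomentum L M → ℂ)
    (F₁₀ : TorusSite 2 L → TorusSite 2 L → ℂ)
    (hsplit : ∀ (p p' : FreqMomentum L M),
      V j t ![((p, 0), 1), ((p', 1), 0), (((omega0 M, y), 0), 0), ((((omega0 M).rev, Qm - x), 1), 1)] *
          V j t ![((p, 0), 0), ((p', 1), 1), ((((omega0 M).rev, Qm - y), 1), 0), (((omega0 M, x), 0), 1)] = c + F₁ p p' + ∑ w, F₂ w p p')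
    {A₁ Kg ε₁ : ℝ} (hA1 : 0 ≤ A₁) (hKg : 0 ≤ Kg) (hε1 : 0 ≤ ε₁)
    (hY0B₁ : ∀ k : TorusSite 2 L, ‖F₁₀ k (k + (Qm - x - y))‖ ≤ A₁)
    (hY1B₁ : ∀ k k' : TorusSite 2 L, ‖F₁₀ k (k + (Qm - x - y)) - F₁₀ k' (k' + (Qm - x - y))‖ ≤ Kg * klTorusNorm L (k - k'))
    (hY0A₁ : ∀ k : TorusSite 2 L, ‖F₁₀ (k + -(Qm - x - y)) k‖ ≤ A₁)
    (hY1A₁ : ∀ k k' : TorusSite 2 L, ‖F₁₀ (k + -(Qm - x - y)) k - F₁₀ (k' + -(Qm - x - y)) k'‖ ≤ Kg * klTorusNorm L (k - k'))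
    {ι : Type*} [Fintype ι] {S : ι → Finset (TorusSite 2 L)} {αc βc Lc : ι → ℝ} (hαβ : ∀ c, αc c ≤ βc c) (hLc : ∀ c, 0 ≤ Lc c)
    {r : ℝ} (hr : 4 * klScale klE0 (n + 1) / (B.Dtmin - 4 * A) + Real.pi / L ≤ r)
    (hserve : ∀ c, ∀ θ ∈ Icc (αc c) (βc c), ∀ k : TorusSite 2 L,
      torusSupNorm (klpeP L k -
        (perturbedFermiRadius (fun k : Fin 2 → ℝ => frameShift K (WithLp.toLp 2 k)) μ θ * Real.cos θ,
          perturbedFermiRadius (fun k : Fin 2 → ℝ => frameShift K (WithLp.toLp 2 k)) μ θ * Real.sin θ)) ≤ r → k ∈ S c)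
    (hcover : ∀ θ ∈ Ioo (-π) π, ∃ c, θ ∈ Icc (αc c) (βc c))
    (hcellB : ∀ c, ∀ k ∈ S c, ∀ k' ∈ S c, ‖F₁₀ k (k + (Qm - x - y)) - F₁₀ k' (k' + (Qm - x - y))‖ ≤ Lc c * klTorusNorm L (k - k'))
    (hcellA : ∀ c, ∀ k ∈ S c, ∀ k' ∈ S c, ‖F₁₀ (k + -(Qm - x - y)) k - F₁₀ (k' + -(Qm - x - y)) k'‖ ≤ Lc c * klTorusNorm L (k - k'))
    (hflat₁ : ∀ (i i' : MatsubaraIdx M) (k k' : TorusSite 2 L), matsubaraInt M i' + 1 = matsubaraInt M i →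
      matsubaraFreq β M i ^ 2 ≤ (5 * klScale klE0 (n + 1)) ^ 2 → ‖F₁ (i, k) (i', k') - F₁₀ k k'‖ ≤ ε₁)
    (cen : ι' → TorusSite 2 L) {ρ A₂ : ι' → ℝ} (hρ : ∀ w, 0 ≤ ρ w) (hA2 : ∀ w, 0 ≤ A₂ w)
    (hF₂ : ∀ w (p p' : FreqMomentum L M), ‖F₂ w p p'‖ ≤ A₂ w)
    (hsupp₂ : ∀ w (p p' : FreqMomentum L M), ρ w < klTorusNorm L (p.2 - cen w) → F₂ w p p' = 0) :
    (klScale klE0 n - klScale klE0 (n + 1)) * ((β * (L : ℝ) ^ 2) ^ 3)⁻¹ *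
        ‖∑ p : FreqMomentum L M, ∑ p' : FreqMomentum L M,
          if matsubaraInt M p'.1 + matsubaraInt M (omega0 M) + matsubaraInt M (omega0 M) + 1 = matsubaraInt M p.1 ∧ p'.2 = p.2 + Qm - x - y then
            ((((((softSymbolCompl L M β μ K (n + 1) j p - softSymbolCompl L M β μ K (n + 1) (n + 1) p) : ℝ) : ℂ) * (((β * (L : ℝ) ^ 2 : ℝ) : ℂ) * propCT L M β μ K p)) *
                  ((((Wd t p') : ℝ) : ℂ) * (((β * (L : ℝ) ^ 2 : ℝ) : ℂ) * propCT L M β μ K p'))) +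
                (((((Wd t p) : ℝ) : ℂ) * (((β * (L : ℝ) ^ 2 : ℝ) : ℂ) * propCT L M β μ K p)) *
                  ((((softSymbolCompl L M β μ K (n + 1) j p' - softSymbolCompl L M β μ K (n + 1) (n + 1) p') : ℝ) : ℂ) * (((β * (L : ℝ) ^ 2 : ℝ) : ℂ) * propCT L M β μ K p')))) *
              (V j t ![((p, 0), 1), ((p', 1), 0), (((omega0 M, y), 0), 0), ((((omega0 M).rev, Qm - x), 1), 1)] *
                V j t ![((p, 0), 0), ((p', 1), 1), ((((omega0 M).rev, Qm - y), 1), 0), (((omega0 M, x), 0), 1)])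
          else 0‖ ≤
      ((klScale klE0 n - klScale klE0 (n + 1)) *
            klmsRowBoundTC B.Dtmin A (4 + 8 / 3 * R.Gfr 1 * U ^ 2) ‖c‖ 0 β n (n + 2) (|-(2 * π / β)| + (4 + 8 / 3 * R.Gfr 1 * U ^ 2) * klTorusNorm L (Qm - x - y)) L +
          (klScale klE0 n - klScale klE0 (n + 1)) *
            klmsRowBoundTC B.Dtmin A (4 + 8 / 3 * R.Gfr 1 * U ^ 2) ‖c‖ 0 β n (n + 2) (|2 * π / β| + (4 + 8 / 3 * R.Gfr 1 * U ^ 2) * klTorusNorm L (Qm - x - y)) L) +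
        ((klScale klE0 n - klScale klE0 (n + 1)) *
            klmsRowBoundTCC B.Dtmin A (4 + 8 / 3 * R.Gfr 1 * U ^ 2) A₁ Kg (∑ c, Lc c * (βc c - αc c))
              (∑ c, (2 * Lc c + 4 * Kg) * (Real.pi / L) * (βc c - αc c)) β n (n + 2)
              (|-(2 * π / β)| + (4 + 8 / 3 * R.Gfr 1 * U ^ 2) * klTorusNorm L (Qm - x - y)) L +
          (klScale klE0 n - klScale klE0 (n + 1)) *
            klmsRowBoundTCC B.Dtmin A (4 + 8 / 3 * R.Gfr 1 * U ^ 2) A₁ Kg (∑ c, Lc c * (βc c - αc c))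
              (∑ c, (2 * Lc c + 4 * Kg) * (Real.pi / L) * (βc c - αc c)) β n (n + 2)
              (|2 * π / β| + (4 + 8 / 3 * R.Gfr 1 * U ^ 2) * klTorusNorm L (Qm - x - y)) L) +
        ε₁ * (512 * 15367) + ∑ w, A₂ w * (1024 * 15381) * (ρ w / π + ((L : ℝ))⁻¹) := by
  have hβ0 : 0 < β := lt_of_lt_of_le (by norm_num [klBetaMin]) hβ
  have hL : (0 : ℝ) < L := by exact_mod_cast Nat.pos_of_ne_zero (NeZero.ne L)
  have hBL : β * (L : ℝ) ^ 2 ≠ 0 := by positivity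
  have hκ : 0 ≤ (klScale klE0 n - klScale klE0 (n + 1)) * ((β * (L : ℝ) ^ 2) ^ 3)⁻¹ := by
    refine mul_nonneg ?_ (by positivity)
    rw [klth_klScale_succ]; linarith [klth_klScale_pos n]
  have h := dLine_pinned_crossed_signed_le_splitCellsTC β μ K B hR hK hAb hA hA20 hμ n ht hβ hβL hn hβn hM Wd hWd V hj Qm x y hlo hhi hq c F₁ F₂ F₁₀ hsplit
    hA1 hKg hε1 hY0B₁ hY1B₁ hY0A₁ hY1A₁ hαβ hLc hr hserve hcover hcellB hcellA hflat₁ cen hρ hA2 hF₂ hsupp₂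
  have hE := pinned_flat_le (M := M) β μ K hK hβ hβL n ht hε1 (C := 256 / 3) (by norm_num) (by norm_num)
  have hW : (klScale klE0 n - klScale klE0 (n + 1)) * ((β * (L : ℝ) ^ 2) ^ 3)⁻¹ *
      (∑ w, A₂ w * (256 / 3 * (β * (L : ℝ) ^ 2) ^ 2 / (klScale klE0 n + t * (klScale klE0 (n + 1) - klScale klE0 n)) ^ 2 *
        (2 * (15381 * (ρ w / π + ((L : ℝ))⁻¹) * klScale klE0 (n + 1) * β * (L : ℝ) ^ 2)))) ≤
      ∑ w, A₂ w * (1024 * 15381) * (ρ w / π + ((L : ℝ))⁻¹) := by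
    rw [Finset.mul_sum]
    exact Finset.sum_le_sum fun w _ => window_flat_le (L := L) β hβ0 n (m := n + 1) le_rfl ht (hA2 w) (C := 256 / 3) (by norm_num) (hρ w)
  exact door_split3_arith hBL h hκ hE hW

end Door

end Summit.HubbardSuperconductivity.HubbardSuperconductivity.Theorems.KLRegimeSplit

end
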